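import Mathlib
import HarnessLib.Audit
import Summits.PneNP.PneNP.Theorems.PstarChordReadFibre

/-!
# THE CLEAN TWO-CHORD THEOREM: two outside-gated slice-generic chords kill a terminal core — no partner hypothesis (ROUND-24, O1; memo g23 §25)

FRONTIER range-avoidance ladder, rung F-N3, ROUND 24 (cell `pnp-ideate`, prover-2 memos `g22/O1-PAIRCORE-g22.md` §20–§24, `g23` §25; typed target
`PstarCoreBoundTargets.TerminalPeelable` (p646951); restricted-model proof complexity — nothing here bears on `P` versus `NP`).

`PstarChordReadTwoChords.false_of_two_gated` needs the two chords to share NO partner; `PstarChordReadHub.false_of_hub` treats one common partner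
under PURITY.  This file removes every hypothesis on the attachments: **two distinct OUTSIDE-GATED slice-generic chords `cᵢ, cⱼ` of a terminal core
are contradictory**, whatever the partners, their multiplicities, types, couplings and further attachments (hubs, stars, triangles, impure hubs
included).  The proof is short and local — it never leaves the FIBRES OF THE TWO (M0) WITNESSES (tools in `PstarChordReadFibre`):

* UPGRADE (`upgrade`): if one channel `Γ_α|_w` (`α` ∈ {`Γ₁`, `Γ₂`, `Γ₁ ⊕ Γ₂`}) is chord-local at `c`, then either it is CONSTANT, or the complementary
  channel `Γ_β|_w` is chord-local at `c` too — a chord-local reader is constant on each private slice of `Sol(J₀)`; if some slice carries the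
  value `b_α`, (T3) makes `Γ_β` miss `b_β` there (restricted slice lemma); if none does, `Γ_α|_w` misses `b_α` on all of `Sol(J₀)` and `gSat`
  makes it constant.
* CONSTANT CHANNELS KILL (`false_of_const`): a channel constant on the fibre of a point `w` with `Γ(w) = b` contradicts (T3) (`gSat` on the other
  channel).
* WITNESSES ARE LIVE (`live_of_witness`): at the (M0) witness `w` of the chord `c` itself (all outputs but `c` satisfied, `Γ(w) = b`), repairing
  `c` by flipping one private (the other being `1`) or both (both being `0`) lands in `Sol(J₀)`, so some private of `c` has a non-zero direction
  at `w`; with the free lunch on the fibre this gives a chord-local channel.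
* Hence (`chordLocal_both_of_witness`) BOTH `Γ₁|_w`, `Γ₂|_w` are chord-local at `c` on the fibre of `c`'s own witness.  On `cᵢ`'s witness fibre this
  makes `Γ₁, Γ₂` blind to the XOR variable `u` of `cⱼ` off `cᵢ` (XOR membership is fibre-independent); on `cⱼ`'s witness fibre chord-locality
  then makes both restricted readers functions of `cⱼ`'s PRIVATES alone, and the solution with the witness's privates (`exists_two_slices`) hits
  both targets: **`false_of_two_clean`**.

Genericity used: `SliceGeneric` at `cᵢ` and at `cⱼ`.  No Assumption A.  Subsumes `false_of_two_gated` (no common partner) and `false_of_hub` (pure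
hub): the only two-generic-chord configurations of a terminal core left open are those with a DIRTY chord (an inside partner).
-/

set_option linter.dupNamespace false -- `Summit.PneNP.PneNP.…`: summit = sub-problem name (D-0017 single-conjunct layout)

open Finset Literature.Computability.Complexity
open scoped symmDiff
open Summit.PneNP.PneNP.Theorems.PstarFibrePolys (bit bit_injective)
open Summit.PneNP.PneNP.Theorems.PstarTyped (Typed)
open Summit.PneNP.PneNP.Theorems.PstarSALevel (varSet bdry BoundaryExpanding SimpleOverlap)
open Summit.PneNP.PneNP.Theorems.PstarGapPeeling (not_mem_varSet_of_private eval_update_of_not_mem eval_pure)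
open Summit.PneNP.PneNP.Theorems.PstarCentreFree (vars_mem_varSet)
open Summit.PneNP.PneNP.Theorems.PstarGapOneAll (gval)
open Summit.PneNP.PneNP.Theorems.PstarGSystemFreeVar (gval_symmDiff)
open Summit.PneNP.PneNP.Theorems.PstarChordRepair (IsChord)
open Summit.PneNP.PneNP.Theorems.PstarCoreBoundTargets (Terminal)
open Summit.PneNP.PneNP.Theorems.PstarGSat (gSat)
open Summit.PneNP.PneNP.Theorems.PstarChordBridgeTools (coef)
open Summit.PneNP.PneNP.Theorems.PstarChordReadLemma (ChordLocal SliceGeneric chordLocal_of_fail_slice)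
open Summit.PneNP.PneNP.Theorems.PstarChordReadGates (sliceGeneric_mono exists_two_slices)
open Summit.PneNP.PneNP.Theorems.PstarChordReadTwoGates (exists_xor_not_mem_of_simpleOverlap)
open Summit.PneNP.PneNP.Theorems.PstarChordReadFlip (mv gval_flip mv_update_of_ne eq_of_pair)
open Summit.PneNP.PneNP.Theorems.PstarChordReadOutside (partners mem_partners_iff IsGate OutsideGated exists_gate_of_slot)
open Summit.PneNP.PneNP.Theorems.PstarChordReadRestrictVar (avoid mem_avoid restrict1 restrictL constL overrideL gval_restrictL restrictL_snd_subset
  overrideL_eq_self)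
open Summit.PneNP.PneNP.Theorems.PstarChordReadNor (fibreList mem_fibreList overrideL_fibreList_of_mem overrideL_fibreList_of_not_mem
  overrideL_fibreList_self solves_overrideL_fibreList mv_congr)
open Summit.PneNP.PneNP.Theorems.PstarChordReadHubLocal (fail₂_of_dir10 fail₁_of_dir01 failSum_of_dir11)
open Summit.PneNP.PneNP.Theorems.PstarChordReadFibre

namespace Summit.PneNP.PneNP.Theorems.PstarChordReadTwoClean

variable {n m : ℕ}

/-! ## Upgrading one local channel; constant channels kill -/
section Upgrade

variable {I : LocalMap 4 n m} {r : ℕ} {y : Fin m → Bool} {J₀ : Finset (Fin m)} {c : Fin m} {𝒢 : Finset (Fin m)}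
  {Cα Cβ : Finset (Fin n)} {Gα Gβ : Finset (Fin m)} {βα ββ : Bool}

/-- On a solution of the core, the XOR pair of `c` reads `y_c ⊕ (x_p ∧ x_q)`. -/
theorem xor_eq_of_solves (hI : I.IsPure xorAndPred) (hc : c ∈ J₀) {x : Fin n → Bool} (hx : ∀ j ∈ J₀, I.eval x j = y j) :
    xor (x (I.vars c 0)) (x (I.vars c 1)) = xor (y c) (x (I.vars c 2) && x (I.vars c 3)) := by
  have h := hx c hc
  rw [eval_pure I hI] at h
  revert h
  generalize (x (I.vars c 2) && x (I.vars c 3)) = t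
  cases x (I.vars c 0) <;> cases x (I.vars c 1) <;> cases y c <;> cases t <;> decide

/-- **UPGRADE.**  Two channels `α = (Cα, Gα, βα)`, `β = (Cβ, Gβ, ββ)` (menus inside `𝒢`) that never hit their targets together on `Sol(J₀)`; `c` an
outside-gated slice-generic chord.  If `Γ_α|_w` is chord-local at `c`, then either it is constant or `Γ_β|_w` is chord-local at `c` too. -/
theorem upgrade (hI : I.IsPure xorAndPred) (hT : Typed I) (hS : SimpleOverlap I) (hB : BoundaryExpanding r I) (hJr : J₀.card ≤ r)
    (hc : c ∈ J₀) (hch : IsChord I J₀ c) (hO : OutsideGated I J₀ 𝒢 c) (hgen : SliceGeneric I y J₀ c 𝒢) (hdisj : Disjoint J₀ 𝒢)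
    (hGα : Gα ⊆ 𝒢) (hGβ : Gβ ⊆ 𝒢)
    (hpm : ∀ x : Fin n → Bool, (∀ j ∈ J₀, I.eval x j = y j) → gval I Cα Gα x = βα → gval I Cβ Gβ x ≠ ββ) (w : Fin n → Bool)
    (hloc : ChordLocal I c (restrictL I Cα Gα (fibreList (outside I J₀) w)).1 (restrictL I Cα Gα (fibreList (outside I J₀) w)).2) :
    (∀ u u' : Fin n → Bool, gval I (restrictL I Cα Gα (fibreList (outside I J₀) w)).1 (restrictL I Cα Gα (fibreList (outside I J₀) w)).2 u =
        gval I (restrictL I Cα Gα (fibreList (outside I J₀) w)).1 (restrictL I Cα Gα (fibreList (outside I J₀) w)).2 u') ∨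
      ChordLocal I c (restrictL I Cβ Gβ (fibreList (outside I J₀) w)).1 (restrictL I Cβ Gβ (fibreList (outside I J₀) w)).2 := by
  classical
  set L := fibreList (outside I J₀) w with hL
  set R := restrictL I Cα Gα L with hR
  obtain ⟨φ, hφ⟩ := hloc
  set target := xor βα (constL I Cα Gα L) with htarget
  have key : ∀ x : Fin n → Bool, (∀ j ∈ J₀, I.eval x j = y j) →
      gval I R.1 R.2 x = φ (xor (y c) (x (I.vars c 2) && x (I.vars c 3))) (x (I.vars c 2)) (x (I.vars c 3)) := by
    intro x hx; rw [hφ x, xor_eq_of_solves hI hc hx]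
  by_cases hex : ∃ π κ : Bool, φ (xor (y c) (π && κ)) π κ = target
  · right
    obtain ⟨π, κ, hπκ⟩ := hex
    refine chordLocal_restrictL_of_fail hI hS hc hch hO hgen hGβ w π κ ββ fun x hx hxp hxq hz => ?_
    have hxL : overrideL x L = x := overrideL_eq_self L x fun p hp => by
      obtain ⟨h1, h2⟩ := mem_fibreList.1 hp
      rw [h2]; exact hz _ h1
    have hα : gval I Cα Gα x = βα := by
      have h := key x hx
      rw [hxp, hxq, hπκ, htarget, hR, gval_restrictL I hI hS, hxL] at h
      revert h; cases gval I Cα Gα x <;> cases βα <;> cases constL I Cα Gα L <;> decide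
    exact hpm x hx hα
  · left
    push Not at hex
    by_contra hnc
    push Not at hnc
    obtain ⟨u, u', huu⟩ := hnc
    obtain ⟨x, hx, hxv⟩ := gSat n m r I hI hT hB hS y J₀ R.2 R.1 target hJr
      (hdisj.mono_right ((restrictL_snd_subset I Cα Gα L).trans hGα)) ⟨u, u', huu⟩
    rw [key x hx] at hxv
    exact hex _ _ hxv

/-- **A CONSTANT CHANNEL KILLS.**  If `Γ_α|_w` is constant, for a point `w` at which both channels are on target, then (T3) for the pair fails. -/
theorem false_of_const (hI : I.IsPure xorAndPred) (hT : Typed I) (hS : SimpleOverlap I) (hB : BoundaryExpanding r I) (hJr : J₀.card ≤ r)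
    (hdisj : Disjoint J₀ 𝒢) (hGβ : Gβ ⊆ 𝒢)
    (hpm : ∀ x : Fin n → Bool, (∀ j ∈ J₀, I.eval x j = y j) → gval I Cα Gα x = βα → gval I Cβ Gβ x ≠ ββ) {w : Fin n → Bool}
    (hwα : gval I Cα Gα w = βα) (hwβ : gval I Cβ Gβ w = ββ) (hsol : ∃ x : Fin n → Bool, ∀ j ∈ J₀, I.eval x j = y j)
    (hconst : ∀ u u' : Fin n → Bool,
      gval I (restrictL I Cα Gα (fibreList (outside I J₀) w)).1 (restrictL I Cα Gα (fibreList (outside I J₀) w)).2 u =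
        gval I (restrictL I Cα Gα (fibreList (outside I J₀) w)).1 (restrictL I Cα Gα (fibreList (outside I J₀) w)).2 u') : False := by
  classical
  set Z := outside I J₀ with hZ
  set L := fibreList Z w with hL
  have hZout : ∀ z ∈ Z, ∀ j ∈ J₀, z ∉ varSet I j := fun z hz => (mem_outside I).1 hz
  obtain ⟨x₀, hx₀⟩ := hsol
  have eα : ∀ x : Fin n → Bool, gval I Cα Gα (overrideL x L) = βα := by
    intro x
    have h := hconst x w
    rw [gval_restrictL I hI hS, gval_restrictL I hI hS, hL, overrideL_fibreList_self, hwα] at h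
    revert h; cases gval I Cα Gα (overrideL x (fibreList Z w)) <;> cases βα <;> cases constL I Cα Gα (fibreList Z w) <;> decide
  by_cases hβ : ∃ u u' : Fin n → Bool, gval I (restrictL I Cβ Gβ L).1 (restrictL I Cβ Gβ L).2 u ≠ gval I (restrictL I Cβ Gβ L).1 (restrictL I Cβ Gβ L).2 u'
  · obtain ⟨x, hx, hxv⟩ := gSat n m r I hI hT hB hS y J₀ (restrictL I Cβ Gβ L).2 (restrictL I Cβ Gβ L).1 (xor ββ (constL I Cβ Gβ L)) hJr
      (hdisj.mono_right ((restrictL_snd_subset I Cβ Gβ L).trans hGβ)) hβ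
    rw [gval_restrictL I hI hS] at hxv
    refine hpm _ (solves_overrideL_fibreList I hZout w hx) (eα x) ?_
    revert hxv; cases gval I Cβ Gβ (overrideL x L) <;> cases ββ <;> cases constL I Cβ Gβ L <;> decide
  · push Not at hβ
    have h := hβ x₀ w
    rw [gval_restrictL I hI hS, gval_restrictL I hI hS, hL, overrideL_fibreList_self, hwβ] at h
    refine hpm _ (solves_overrideL_fibreList I hZout w hx₀) (eα x₀) ?_
    revert h; cases gval I Cβ Gβ (overrideL x₀ (fibreList Z w)) <;> cases ββ <;> cases constL I Cβ Gβ (fibreList Z w) <;> decide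

end Upgrade

/-! ## Witnesses are live; both readers are chord-local on the witness fibre -/
section Witness

variable {I : LocalMap 4 n m} {r : ℕ} {y : Fin m → Bool} {J₀ : Finset (Fin m)} {w₁ w₂ : Finset (Fin n) × Finset (Fin m) × Bool} {c : Fin m}

/-- **THE (M0) WITNESS OF A CHORD IS LIVE.**  At the witness `w` of `c` (all outputs but `c` satisfied, both readers on target) some private of `c`
moves a reader: repairing `c` by flipping one private (the other being `1`) or both (both being `0`) lands in `Sol(J₀)`, where (T3) forbids the
targets. -/
theorem live_of_witness (hI : I.IsPure xorAndPred) (hS : SimpleOverlap I) (ht : Terminal I r y J₀ w₁ w₂) (hc : c ∈ J₀) (hch : IsChord I J₀ c)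
    {w : Fin n → Bool} (hw : ∀ j ∈ J₀.erase c, I.eval w j = y j) (hw₁ : gval I w₁.1 w₁.2.1 w = w₁.2.2)
    (hw₂ : gval I w₂.1 w₂.2.1 w = w₂.2.2) :
    ∃ v v' : Fin n, ((I.vars c 2 = v ∧ I.vars c 3 = v') ∨ (I.vars c 2 = v' ∧ I.vars c 3 = v)) ∧
      (mv I w₁.1 w₁.2.1 v w = true ∨ mv I w₂.1 w₂.2.1 v w = true) := by
  classical
  have T := fun (z : Fin n → Bool) (hz : ∀ j ∈ J₀, I.eval z j = y j) (a : gval I w₁.1 w₁.2.1 z = w₁.2.2)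
    (b : gval I w₂.1 w₂.2.1 z = w₂.2.2) => ht.2.2.2.2.2.2.1 ⟨z, hz, a, b⟩
  have h02 : I.vars c 0 ≠ I.vars c 2 := fun e => absurd (hI.2 c e) (by decide)
  have h03 : I.vars c 0 ≠ I.vars c 3 := fun e => absurd (hI.2 c e) (by decide)
  have h12 : I.vars c 1 ≠ I.vars c 2 := fun e => absurd (hI.2 c e) (by decide)
  have h13 : I.vars c 1 ≠ I.vars c 3 := fun e => absurd (hI.2 c e) (by decide)
  have h23 : I.vars c 2 ≠ I.vars c 3 := fun e => absurd (hI.2 c e) (by decide)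
  have hp : ∀ j ∈ J₀, j ≠ c → I.vars c 2 ∉ varSet I j := fun j hj hne => not_mem_varSet_of_private I hc hj hne hch.1 (vars_mem_varSet I c 2)
  have hq : ∀ j ∈ J₀, j ≠ c → I.vars c 3 ∉ varSet I j := fun j hj hne => not_mem_varSet_of_private I hc hj hne hch.2 (vars_mem_varSet I c 3)
  have hwc : I.eval w c ≠ y c := by
    intro h
    refine T w (fun j hj => ?_) hw₁ hw₂
    by_cases hjc : j = c
    · rw [hjc]; exact h
    · exact hw j (mem_erase.2 ⟨hjc, hj⟩)
  rw [eval_pure I hI] at hwc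
  -- no menu monomial is the AND pair of `c`
  have hno : ∀ G, Disjoint J₀ G → ∀ g ∈ G, ¬ ((I.vars g 2 = I.vars c 3 ∧ I.vars g 3 = I.vars c 2) ∨ (I.vars g 2 = I.vars c 2 ∧ I.vars g 3 = I.vars c 3)) := by
    intro G hG g hg h
    have hgc : g = c := eq_of_pair I hS h23.symm h (Or.inr ⟨rfl, rfl⟩)
    exact disjoint_left.1 hG hc (hgc ▸ hg)
  -- solving the other outputs after updates at privates
  have other : ∀ (z : Fin n → Bool), (∀ j ∈ J₀.erase c, I.eval z j = I.eval w j) → I.eval z c = y c → ∀ j ∈ J₀, I.eval z j = y j := by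
    intro z hz hzc j hj
    by_cases hjc : j = c
    · rw [hjc]; exact hzc
    · rw [hz j (mem_erase.2 ⟨hjc, hj⟩)]; exact hw j (mem_erase.2 ⟨hjc, hj⟩)
  by_cases hq1 : w (I.vars c 3) = true
  · -- flip `p`
    refine ⟨I.vars c 2, I.vars c 3, Or.inl ⟨rfl, rfl⟩, ?_⟩
    set w' := Function.update w (I.vars c 2) (!w (I.vars c 2)) with hw'
    have hs' : ∀ j ∈ J₀, I.eval w' j = y j := by
      refine other w' (fun j hj => eval_update_of_not_mem I j w (hp j (mem_of_mem_erase hj) (ne_of_mem_erase hj)) _) ?_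
      rw [eval_pure I hI, hw', Function.update_self, Function.update_of_ne h02, Function.update_of_ne h12, Function.update_of_ne h23.symm, hq1]
      rw [hq1] at hwc
      revert hwc; cases w (I.vars c 0) <;> cases w (I.vars c 1) <;> cases w (I.vars c 2) <;> cases y c <;> decide
    have e₁ := gval_flip I w₁.1 w₁.2.1 hI w (I.vars c 2)
    have e₂ := gval_flip I w₂.1 w₂.2.1 hI w (I.vars c 2)
    rw [hw₁] at e₁
    rw [hw₂] at e₂
    by_contra hboth
    push Not at hboth
    obtain ⟨hm₁, hm₂⟩ := hboth
    rw [Bool.eq_false_iff.2 hm₁, Bool.xor_false] at e₁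
    rw [Bool.eq_false_iff.2 hm₂, Bool.xor_false] at e₂
    exact T w' hs' e₁ e₂
  · by_cases hp1 : w (I.vars c 2) = true
    · -- flip `q`
      refine ⟨I.vars c 3, I.vars c 2, Or.inr ⟨rfl, rfl⟩, ?_⟩
      set w' := Function.update w (I.vars c 3) (!w (I.vars c 3)) with hw'
      have hs' : ∀ j ∈ J₀, I.eval w' j = y j := by
        refine other w' (fun j hj => eval_update_of_not_mem I j w (hq j (mem_of_mem_erase hj) (ne_of_mem_erase hj)) _) ?_
        rw [eval_pure I hI, hw', Function.update_self, Function.update_of_ne h03, Function.update_of_ne h13, Function.update_of_ne h23, hp1]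
        rw [hp1] at hwc
        revert hwc hq1; cases w (I.vars c 0) <;> cases w (I.vars c 1) <;> cases w (I.vars c 3) <;> cases y c <;> decide
      have e₁ := gval_flip I w₁.1 w₁.2.1 hI w (I.vars c 3)
      have e₂ := gval_flip I w₂.1 w₂.2.1 hI w (I.vars c 3)
      rw [hw₁] at e₁
      rw [hw₂] at e₂
      by_contra hboth
      push Not at hboth
      obtain ⟨hm₁, hm₂⟩ := hboth
      rw [Bool.eq_false_iff.2 hm₁, Bool.xor_false] at e₁
      rw [Bool.eq_false_iff.2 hm₂, Bool.xor_false] at e₂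
      exact T w' hs' e₁ e₂
    · -- flip both
      have hp0 : w (I.vars c 2) = false := Bool.eq_false_iff.2 hp1
      have hq0 : w (I.vars c 3) = false := Bool.eq_false_iff.2 hq1
      set w' := Function.update w (I.vars c 2) (!w (I.vars c 2)) with hw'
      set w'' := Function.update w' (I.vars c 3) (!w' (I.vars c 3)) with hw''
      have hs'' : ∀ j ∈ J₀, I.eval w'' j = y j := by
        refine other w'' (fun j hj => ?_) ?_
        · rw [hw'', eval_update_of_not_mem I j w' (hq j (mem_of_mem_erase hj) (ne_of_mem_erase hj)), hw',
            eval_update_of_not_mem I j w (hp j (mem_of_mem_erase hj) (ne_of_mem_erase hj))]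
        · rw [eval_pure I hI, hw'', Function.update_self, Function.update_of_ne h03, Function.update_of_ne h13, Function.update_of_ne h23,
            hw', Function.update_self, Function.update_of_ne h02, Function.update_of_ne h12, Function.update_of_ne h23.symm, hp0, hq0]
          rw [hp0, hq0] at hwc
          revert hwc; cases w (I.vars c 0) <;> cases w (I.vars c 1) <;> cases y c <;> decide
      have e₁ : gval I w₁.1 w₁.2.1 w'' = xor (xor w₁.2.2 (mv I w₁.1 w₁.2.1 (I.vars c 2) w)) (mv I w₁.1 w₁.2.1 (I.vars c 3) w) := by
        rw [hw'', gval_flip I w₁.1 w₁.2.1 hI, hw', gval_flip I w₁.1 w₁.2.1 hI, hw₁,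
          mv_update_of_ne I w₁.1 w₁.2.1 (hno w₁.2.1 ht.2.2.2.1)]
      have e₂ : gval I w₂.1 w₂.2.1 w'' = xor (xor w₂.2.2 (mv I w₂.1 w₂.2.1 (I.vars c 2) w)) (mv I w₂.1 w₂.2.1 (I.vars c 3) w) := by
        rw [hw'', gval_flip I w₂.1 w₂.2.1 hI, hw', gval_flip I w₂.1 w₂.2.1 hI, hw₂,
          mv_update_of_ne I w₂.1 w₂.2.1 (hno w₂.2.1 ht.2.2.2.2.1)]
      by_cases hpl : mv I w₁.1 w₁.2.1 (I.vars c 2) w = true ∨ mv I w₂.1 w₂.2.1 (I.vars c 2) w = true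
      · exact ⟨I.vars c 2, I.vars c 3, Or.inl ⟨rfl, rfl⟩, hpl⟩
      · refine ⟨I.vars c 3, I.vars c 2, Or.inr ⟨rfl, rfl⟩, ?_⟩
        push Not at hpl
        rw [Bool.eq_false_iff.2 hpl.1] at e₁
        rw [Bool.eq_false_iff.2 hpl.2] at e₂
        by_contra hboth
        push Not at hboth
        rw [Bool.eq_false_iff.2 hboth.1] at e₁
        rw [Bool.eq_false_iff.2 hboth.2] at e₂
        exact T w'' hs'' (by rw [e₁]; cases w₁.2.2 <;> rfl) (by rw [e₂]; cases w₂.2.2 <;> rfl)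

/-- **BOTH READERS ARE CHORD-LOCAL ON THE WITNESS FIBRE** of an outside-gated slice-generic chord. -/
theorem chordLocal_both_of_witness (hI : I.IsPure xorAndPred) (hT : Typed I) (hS : SimpleOverlap I) (hB : BoundaryExpanding r I)
    (ht : Terminal I r y J₀ w₁ w₂) (hc : c ∈ J₀) (hch : IsChord I J₀ c) (hO : OutsideGated I J₀ (w₁.2.1 ∪ w₂.2.1) c)
    (hgen : SliceGeneric I y J₀ c (w₁.2.1 ∪ w₂.2.1)) (hsol : ∃ x : Fin n → Bool, ∀ j ∈ J₀, I.eval x j = y j) {w : Fin n → Bool}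
    (hw : ∀ j ∈ J₀.erase c, I.eval w j = y j) (hw₁ : gval I w₁.1 w₁.2.1 w = w₁.2.2) (hw₂ : gval I w₂.1 w₂.2.1 w = w₂.2.2) :
    ChordLocal I c (restrictL I w₁.1 w₁.2.1 (fibreList (outside I J₀) w)).1 (restrictL I w₁.1 w₁.2.1 (fibreList (outside I J₀) w)).2 ∧
      ChordLocal I c (restrictL I w₂.1 w₂.2.1 (fibreList (outside I J₀) w)).1 (restrictL I w₂.1 w₂.2.1 (fibreList (outside I J₀) w)).2 := by
  classical
  have hJr : J₀.card ≤ r := ht.2.2.1.le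
  have hdisj : Disjoint J₀ (w₁.2.1 ∪ w₂.2.1) := disjoint_union_right.2 ⟨ht.2.2.2.1, ht.2.2.2.2.1⟩
  have T := fun (z : Fin n → Bool) (hz : ∀ j ∈ J₀, I.eval z j = y j) (a : gval I w₁.1 w₁.2.1 z = w₁.2.2)
    (b : gval I w₂.1 w₂.2.1 z = w₂.2.2) => ht.2.2.2.2.2.2.1 ⟨z, hz, a, b⟩
  -- the three pair-miss facts
  have pm₂₁ : ∀ x : Fin n → Bool, (∀ j ∈ J₀, I.eval x j = y j) → gval I w₂.1 w₂.2.1 x = w₂.2.2 → gval I w₁.1 w₁.2.1 x ≠ w₁.2.2 :=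
    fun x hx h₂ h₁ => T x hx h₁ h₂
  have pm₁₂ : ∀ x : Fin n → Bool, (∀ j ∈ J₀, I.eval x j = y j) → gval I w₁.1 w₁.2.1 x = w₁.2.2 → gval I w₂.1 w₂.2.1 x ≠ w₂.2.2 :=
    fun x hx h₁ h₂ => T x hx h₁ h₂
  have pmS₂ : ∀ x : Fin n → Bool, (∀ j ∈ J₀, I.eval x j = y j) → gval I (w₁.1 ∆ w₂.1) (w₁.2.1 ∆ w₂.2.1) x = xor w₁.2.2 w₂.2.2 →
      gval I w₂.1 w₂.2.1 x ≠ w₂.2.2 := by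
    intro x hx hS₁₂ h₂
    rw [gval_symmDiff, h₂] at hS₁₂
    exact T x hx (by revert hS₁₂; cases gval I w₁.1 w₁.2.1 x <;> cases w₁.2.2 <;> cases w₂.2.2 <;> decide) h₂
  have hwS : gval I (w₁.1 ∆ w₂.1) (w₁.2.1 ∆ w₂.2.1) w = xor w₁.2.2 w₂.2.2 := by rw [gval_symmDiff, hw₁, hw₂]
  have U₂₁ := upgrade hI hT hS hB hJr hc hch hO hgen hdisj subset_union_right subset_union_left pm₂₁ w
  have U₁₂ := upgrade hI hT hS hB hJr hc hch hO hgen hdisj subset_union_left subset_union_right pm₁₂ w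
  have US₂ := upgrade hI hT hS hB hJr hc hch hO hgen hdisj (symmDiff_subset_union' _ _) subset_union_right pmS₂ w
  have K₂₁ := false_of_const hI hT hS hB hJr hdisj subset_union_left pm₂₁ hw₂ hw₁ hsol
  have K₁₂ := false_of_const hI hT hS hB hJr hdisj subset_union_right pm₁₂ hw₁ hw₂ hsol
  have KS₂ := false_of_const hI hT hS hB hJr hdisj subset_union_right pmS₂ hwS hw₂ hsol
  obtain ⟨v, v', hvv, hlive⟩ := live_of_witness hI hS ht hc hch hw hw₁ hw₂
  rcases h₁ : mv I w₁.1 w₁.2.1 v w with _ | _ <;> rcases h₂ : mv I w₂.1 w₂.2.1 v w with _ | _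
  · rw [h₁, h₂] at hlive; exact absurd hlive (by simp)
  · have L₁ := local₁_of_dir01 hI hS ht hc hch hO hgen hvv w h₁ h₂
    rcases U₁₂ L₁ with hk | L₂
    · exact (K₁₂ hk).elim
    · exact ⟨L₁, L₂⟩
  · have L₂ := local₂_of_dir10 hI hS ht hc hch hO hgen hvv w h₁ h₂
    rcases U₂₁ L₂ with hk | L₁
    · exact (K₂₁ hk).elim
    · exact ⟨L₁, L₂⟩
  · have LS := local₁₂_of_dir11 hI hS ht hc hch hO hgen hvv w h₁ h₂
    rcases US₂ LS with hk | L₂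
    · exact (KS₂ hk).elim
    · rcases U₂₁ L₂ with hk | L₁
      · exact (K₂₁ hk).elim
      · exact ⟨L₁, L₂⟩

end Witness

/-! ## The clean two-chord theorem -/
section Main

variable {I : LocalMap 4 n m} {r : ℕ} {y : Fin m → Bool} {J₀ : Finset (Fin m)} {w₁ w₂ : Finset (Fin n) × Finset (Fin m) × Bool}
  {cᵢ cⱼ : Fin m}

/-- **THE CLEAN TWO-CHORD THEOREM.**  On a pure typed `(r,3/2)`-expanding instance with simple overlaps, a terminal core has no two distinct chords that
are OUTSIDE-GATED (every monomial of `Γ₁, Γ₂` touching the AND pair is a gate `(v, z)` with `z` outside the core) and SLICE-GENERIC.  Nothing is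
assumed about the partners: common partners, several partners per private, arbitrary types and arbitrary further attachments are all allowed. -/
theorem false_of_two_clean (hI : I.IsPure xorAndPred) (hT : Typed I) (hS : SimpleOverlap I) (hB : BoundaryExpanding r I)
    (ht : Terminal I r y J₀ w₁ w₂) (hcᵢ : cᵢ ∈ J₀) (hcⱼ : cⱼ ∈ J₀) (hne : cᵢ ≠ cⱼ) (hchᵢ : IsChord I J₀ cᵢ) (hchⱼ : IsChord I J₀ cⱼ)
    (hOᵢ : OutsideGated I J₀ (w₁.2.1 ∪ w₂.2.1) cᵢ) (hOⱼ : OutsideGated I J₀ (w₁.2.1 ∪ w₂.2.1) cⱼ)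
    (hgenᵢ : SliceGeneric I y J₀ cᵢ (w₁.2.1 ∪ w₂.2.1)) (hgenⱼ : SliceGeneric I y J₀ cⱼ (w₁.2.1 ∪ w₂.2.1)) : False := by
  classical
  have T := fun (z : Fin n → Bool) (hz : ∀ j ∈ J₀, I.eval z j = y j) (a : gval I w₁.1 w₁.2.1 z = w₁.2.2)
    (b : gval I w₂.1 w₂.2.1 z = w₂.2.2) => ht.2.2.2.2.2.2.1 ⟨z, hz, a, b⟩
  have hvᵢ := exists_xor_not_mem_of_simpleOverlap hI hS hne
  obtain ⟨s, hs2, hsn⟩ := exists_xor_not_mem_of_simpleOverlap hI hS hne.symm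
  set Z := outside I J₀ with hZ
  have hZout : ∀ z ∈ Z, ∀ j ∈ J₀, z ∉ varSet I j := fun z hz => (mem_outside I).1 hz
  have hsol : ∃ x : Fin n → Bool, ∀ j ∈ J₀, I.eval x j = y j := by
    obtain ⟨x, hx, -⟩ := exists_two_slices hI hcᵢ hcⱼ hne hchᵢ hchⱼ hvᵢ hgenᵢ false false false false
    exact ⟨x, hx⟩
  -- the two witnesses and the locality of both readers on their fibres
  obtain ⟨wᵢ, hwᵢ, hwᵢ₁, hwᵢ₂⟩ := ht.2.2.2.2.2.2.2 cᵢ hcᵢ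
  obtain ⟨wⱼ, hwⱼ, hwⱼ₁, hwⱼ₂⟩ := ht.2.2.2.2.2.2.2 cⱼ hcⱼ
  obtain ⟨Lᵢ₁, Lᵢ₂⟩ := chordLocal_both_of_witness hI hT hS hB ht hcᵢ hchᵢ hOᵢ hgenᵢ hsol hwᵢ hwᵢ₁ hwᵢ₂
  obtain ⟨Lⱼ₁, Lⱼ₂⟩ := chordLocal_both_of_witness hI hT hS hB ht hcⱼ hchⱼ hOⱼ hgenⱼ hsol hwⱼ hwⱼ₁ hwⱼ₂
  -- the XOR variable `u` of `cⱼ` off `cᵢ`: unread by both readers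
  set u := I.vars cⱼ s with hu
  have huM : ∀ (G : Finset (Fin m)), ∀ g ∈ G, I.vars g 2 ≠ u ∧ I.vars g 3 ≠ u :=
    fun G g _ => ⟨(hT cⱼ g s 2 hs2 (by decide)).symm, (hT cⱼ g s 3 hs2 (by decide)).symm⟩
  have huᵢ : ∀ t : Fin 4, u ≠ I.vars cᵢ t := fun t e => hsn (e ▸ vars_mem_varSet I cᵢ t)
  have huZ : ∀ (w : Fin n → Bool), ∀ p ∈ fibreList Z w, p.1 ≠ u := fun w p hp e =>
    not_mem_outside_of_mem I hcⱼ (hu ▸ vars_mem_varSet I cⱼ s) (e ▸ (mem_fibreList.1 hp).1)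
  have hu₁ : u ∉ w₁.1 := (mem_restrictL_fst_iff I hI w₁.1 w₁.2.1 (huM _) _ (huZ wᵢ)).not.1
    (not_mem_of_chordLocal hI Lᵢ₁ (huᵢ 0) (huᵢ 1) (huᵢ 2) (huᵢ 3) (huM _))
  have hu₂ : u ∉ w₂.1 := (mem_restrictL_fst_iff I hI w₂.1 w₂.2.1 (huM _) _ (huZ wᵢ)).not.1
    (not_mem_of_chordLocal hI Lᵢ₂ (huᵢ 0) (huᵢ 1) (huᵢ 2) (huᵢ 3) (huM _))
  -- on `cⱼ`'s witness fibre both restricted readers are functions of `cⱼ`'s privates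
  have ha : ∀ {C : Finset (Fin n)} {G : Finset (Fin m)}, u ∉ C →
      ChordLocal I cⱼ (restrictL I C G (fibreList Z wⱼ)).1 (restrictL I C G (fibreList Z wⱼ)).2 →
      I.vars cⱼ 0 ∉ (restrictL I C G (fibreList Z wⱼ)).1 := by
    intro C G huC hloc h0
    have hux : u ∉ (restrictL I C G (fibreList Z wⱼ)).1 := (mem_restrictL_fst_iff I hI C G (huM _) _ (huZ wⱼ)).not.2 huC
    have h01 := xor_mem_iff_of_chordLocal hI hT hloc
    have hs01 : s = 0 ∨ s = 1 := by
      rcases s with ⟨s, hs⟩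
      rcases s with _ | _ | s
      · exact Or.inl rfl
      · exact Or.inr rfl
      · exact absurd hs2 (by simp)
    rcases hs01 with e | e
    · exact hux (by rw [hu, e]; exact h0)
    · exact hux (by rw [hu, e]; exact h01.1 h0)
  obtain ⟨ψ₁, hψ₁⟩ := indep_of_chordLocal hI hT Lⱼ₁ (ha hu₁ Lⱼ₁)
  obtain ⟨ψ₂, hψ₂⟩ := indep_of_chordLocal hI hT Lⱼ₂ (ha hu₂ Lⱼ₂)
  -- the solution with the witness's privates hits both targets
  obtain ⟨x, hx, -, -, exp, exq⟩ := exists_two_slices hI hcᵢ hcⱼ hne hchᵢ hchⱼ hvᵢ hgenᵢ false false (wⱼ (I.vars cⱼ 2)) (wⱼ (I.vars cⱼ 3))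
  have hxs := solves_overrideL_fibreList I hZout wⱼ hx
  have g₁ : gval I w₁.1 w₁.2.1 (overrideL x (fibreList Z wⱼ)) = w₁.2.2 := by
    have h := hψ₁ x
    have h' := hψ₁ wⱼ
    rw [gval_restrictL I hI hS, exp, exq] at h
    rw [gval_restrictL I hI hS, overrideL_fibreList_self, hwⱼ₁] at h'
    rw [← h'] at h
    revert h; cases gval I w₁.1 w₁.2.1 (overrideL x (fibreList Z wⱼ)) <;> cases w₁.2.2 <;> cases constL I w₁.1 w₁.2.1 (fibreList Z wⱼ) <;> decide
  have g₂ : gval I w₂.1 w₂.2.1 (overrideL x (fibreList Z wⱼ)) = w₂.2.2 := by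
    have h := hψ₂ x
    have h' := hψ₂ wⱼ
    rw [gval_restrictL I hI hS, exp, exq] at h
    rw [gval_restrictL I hI hS, overrideL_fibreList_self, hwⱼ₂] at h'
    rw [← h'] at h
    revert h; cases gval I w₂.1 w₂.2.1 (overrideL x (fibreList Z wⱼ)) <;> cases w₂.2.2 <;> cases constL I w₂.1 w₂.2.1 (fibreList Z wⱼ) <;> decide
  exact T _ hxs g₁ g₂

end Main

end Summit.PneNP.PneNP.Theorems.PstarChordReadTwoClean
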